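import Summits.AtomisticToContinuum.HydrodynamicLimit.Theorems.CollisionIsometryCLTAdaptedWeightCLTBlockHDissipation

/-!
# DV transfer for the line `block-h-dissipation-closure` (crux `AdaptedWeightCLT`, stmt-AtomisticToContinuum-14868),
# file 6: the probabilistic bookkeeping of the transfer `EntropyChaosRelOn ⇒ OneSidedOn`

Support file (`--supports stmt-AtomisticToContinuum-14868`, anchor `bhDVTransfer_glue_anchor`) of the line lead
`prover-line-stmt-AtomisticToContinuum-14868-c4-0`, written for the registered stub `stub_dvTransfer` (S2).

`oneSidedOn_of_dvChain` isolates, as four `Tendsto` hypotheses over two ABSTRACT functionals `A N z` ("DV action":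
in the line, `(N+1)⁻¹ Σ_k ∫ₓ 𝟙{pairZ > 0} (−½ ∫ ΔΛ · contactDens)`) and `E N z` ("cross-Hellinger mass": in the line,
`(N+1)⁻¹ Σ_k ∫ₓ 𝟙{pairZ > 0} contactMass · (1 − ∫ e^{ΔΛ/2} chaosDens)`), exactly what the Donsker–Varadhan route of
the stub consumes, and proves that they turn the residue `EntropyChaosRelOn` into `OneSidedOn` with
`c₁ = (1 − δ) c₀ / K₀`:

* (G1) INCREMENTS-TO-MEASURE (one-sided): `P{realDiss + η(N+1)^{1/3} < (1 − δ) A} → 0` — moving the mollifier from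
  the observable to the measure, window-start vs contact-time cell law, weight symmetrisation `cw_a ↦ ½(cw_i + cw_j)`,
  the co-moving floor shift, and the junk cell-windows (`pairZ = 0`), all summed over the realised contacts;
* (G2) THE DV INEQUALITY IN AGGREGATE: `P{A + η(N+1)^{1/3} < E − relEnt} → 0` — deterministic on the good set by
  file 5 (`dv_step`, per `(k, x)`) plus integrability in `x`; 
* (G3) CROSS-HELLINGER (one-sided): `P{E + η(N+1)^{1/3} < chaosDissW} → 0` — the KDE commutator and the floor
  mismatch between the smeared atomic pair law and `f̂ ⊗ f̂ B/Z(f̂)` (for which file 2 gives `E`'s summand `=`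
  `contactMass · hellDiss f̂` exactly);
* (G4) WINDOW-START VS CONTACT-TIME chaotic dissipation: `P{K₀ chaosDissW + η(N+1)^{1/3} < chaosDiss} → 0`.

(G1), (G3), (G4) are the per-contact commutator inputs of the stub's docstring (its items (i), (iii)(a)(b), (iii)(c));
they are NOT consequences of `TailsOn` + `FewCollisionsOn` alone (lonely / hyperactive cell-windows), which is why
the worker reports `stub_dvTransfer` as mis-stated and lands the transfer in this conditional form. Pure
bookkeeping otherwise (union bound with split slack); no definitions.
-/

namespace Summit.AtomisticToContinuum.HydrodynamicLimit.Theorems.BlockHDissipation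

open scoped BigOperators Topology Classical MeasureTheory ENNReal InnerProductSpace
open Filter Set MeasureTheory
open Literature.Analysis.FluidPDE
open Summit.AtomisticToContinuum.HydrodynamicLimit.Theorems.ContactSourceDuhamel (T3 V3 Cfg Vel Flow Flows)
open Summit.AtomisticToContinuum.HydrodynamicLimit.Theorems.ContactSourceDuhamel.TimeLocal
open Literature.MathematicalPhysics.KineticTheory (hsDiameter localGibbsLaw collide hardSphereKernel
  sphereMeasure)

noncomputable section

namespace DVTransfer

/-- **The transfer `EntropyChaosRelOn ⇒ OneSidedOn`, conditional form.** For `δ < 1`, `K₀ > 0` and two functionals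
`A` (DV action) and `E` (cross-Hellinger mass) satisfying (G1) `realDiss ≥ (1−δ) A − o_P((N+1)^{1/3})`,
(G2) `A ≥ E − relEnt − o_P((N+1)^{1/3})`, (G3) `E ≥ chaosDissW − o_P((N+1)^{1/3})`,
(G4) `chaosDiss ≤ K₀ chaosDissW + o_P((N+1)^{1/3})`, the residue `EntropyChaosRelOn` (constant `c₀`) gives
`OneSidedOn` with `c₁ = (1 − δ) c₀ / K₀`. -/
theorem oneSidedOn_of_dvChain {σ : ℝ} {a₀ θ₀ : T3 → ℝ} {u₀ : T3 → V3} {Φ : Flows σ} {ψ : ℕ → T3 → ℝ}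
    {γc h δ t : ℝ} (hδ : δ < 1) (A E : (N : ℕ) → Cfg N → ℝ) {K₀ : ℝ} (hK₀ : 0 < K₀)
    (G1 : ∀ η : ℝ, 0 < η → Tendsto (fun N : ℕ => localGibbsLaw σ a₀ u₀ θ₀ N (Φ N)
      {z | realDiss σ N (Φ N) ψ h δ t z + η * ((N + 1 : ℕ) : ℝ) ^ ((1 : ℝ) / 3) < (1 - δ) * A N z}) atTop (𝓝 0))
    (G2 : ∀ η : ℝ, 0 < η → Tendsto (fun N : ℕ => localGibbsLaw σ a₀ u₀ θ₀ N (Φ N)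
      {z | A N z + η * ((N + 1 : ℕ) : ℝ) ^ ((1 : ℝ) / 3) < E N z - relEnt σ N (Φ N) ψ γc h t z}) atTop (𝓝 0))
    (G3 : ∀ η : ℝ, 0 < η → Tendsto (fun N : ℕ => localGibbsLaw σ a₀ u₀ θ₀ N (Φ N)
      {z | E N z + η * ((N + 1 : ℕ) : ℝ) ^ ((1 : ℝ) / 3) < chaosDissW σ N (Φ N) ψ γc h δ t z}) atTop (𝓝 0))
    (G4 : ∀ η : ℝ, 0 < η → Tendsto (fun N : ℕ => localGibbsLaw σ a₀ u₀ θ₀ N (Φ N)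
      {z | K₀ * chaosDissW σ N (Φ N) ψ γc h δ t z + η * ((N + 1 : ℕ) : ℝ) ^ ((1 : ℝ) / 3) <
        chaosDiss σ N (Φ N) ψ h δ t z}) atTop (𝓝 0))
    (hR : EntropyChaosRelOn σ a₀ θ₀ u₀ Φ ψ γc h δ t) : OneSidedOn σ a₀ θ₀ u₀ Φ ψ h δ t := by
  obtain ⟨c₀, hc₀, -, hR⟩ := hR
  have h1δ : 0 < 1 - δ := by linarith
  set c₁ : ℝ := (1 - δ) * c₀ / K₀ with hc₁_def
  have hc₁ : 0 < c₁ := by rw [hc₁_def]; positivity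
  refine ⟨c₁, hc₁, fun η hη => ?_⟩
  -- split the slack
  set D : ℝ := c₁ + 3 * (1 - δ) + 1 with hD_def
  have hD : 0 < D := by rw [hD_def]; positivity
  set η' : ℝ := η / D with hη'_def
  have hη' : 0 < η' := by rw [hη'_def]; positivity
  have hDη' : D * η' = η := by rw [hη'_def]; field_simp
  -- the five bad events
  let S : (N : ℕ) → ℝ := fun N => ((N + 1 : ℕ) : ℝ) ^ ((1 : ℝ) / 3)
  let E1 : (N : ℕ) → Set (Cfg N) := fun N =>
    {z | realDiss σ N (Φ N) ψ h δ t z + η' * S N < (1 - δ) * A N z}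
  let E2 : (N : ℕ) → Set (Cfg N) := fun N =>
    {z | A N z + η' * S N < E N z - relEnt σ N (Φ N) ψ γc h t z}
  let E3 : (N : ℕ) → Set (Cfg N) := fun N =>
    {z | E N z + η' * S N < chaosDissW σ N (Φ N) ψ γc h δ t z}
  let E4 : (N : ℕ) → Set (Cfg N) := fun N =>
    {z | K₀ * chaosDissW σ N (Φ N) ψ γc h δ t z + η' * S N < chaosDiss σ N (Φ N) ψ h δ t z}
  let E5 : (N : ℕ) → Set (Cfg N) := fun N =>
    {z | (1 - c₀) * chaosDissW σ N (Φ N) ψ γc h δ t z + η' * S N < relEnt σ N (Φ N) ψ γc h t z}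
  have T1 : Tendsto (fun N : ℕ => localGibbsLaw σ a₀ u₀ θ₀ N (Φ N) (E1 N)) atTop (𝓝 0) := G1 η' hη'
  have T2 : Tendsto (fun N : ℕ => localGibbsLaw σ a₀ u₀ θ₀ N (Φ N) (E2 N)) atTop (𝓝 0) := G2 η' hη'
  have T3' : Tendsto (fun N : ℕ => localGibbsLaw σ a₀ u₀ θ₀ N (Φ N) (E3 N)) atTop (𝓝 0) := G3 η' hη'
  have T4 : Tendsto (fun N : ℕ => localGibbsLaw σ a₀ u₀ θ₀ N (Φ N) (E4 N)) atTop (𝓝 0) := G4 η' hη'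
  have T5 : Tendsto (fun N : ℕ => localGibbsLaw σ a₀ u₀ θ₀ N (Φ N) (E5 N)) atTop (𝓝 0) := hR η' hη'
  -- inclusion of the target event in the union of the bad events
  have hincl : ∀ N : ℕ, {z | realDiss σ N (Φ N) ψ h δ t z + η * ((N + 1 : ℕ) : ℝ) ^ ((1 : ℝ) / 3) <
      c₁ * chaosDiss σ N (Φ N) ψ h δ t z} ⊆ (((E1 N ∪ E2 N) ∪ E3 N) ∪ E4 N) ∪ E5 N := by
    intro N z hz
    simp only [mem_setOf_eq] at hz
    by_contra hnot
    simp only [mem_union, mem_setOf_eq, not_or, not_lt, E1, E2, E3, E4, E5] at hnot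
    obtain ⟨⟨⟨⟨h1, h2⟩, h3⟩, h4⟩, h5⟩ := hnot
    have hS : 0 ≤ S N := (Real.rpow_pos_of_pos (by exact_mod_cast Nat.succ_pos N) _).le
    -- chain the deterministic inequalities on the good event
    set R := realDiss σ N (Φ N) ψ h δ t z
    set a := A N z
    set e := E N z
    set r := relEnt σ N (Φ N) ψ γc h t z
    set W := chaosDissW σ N (Φ N) ψ γc h δ t z
    set C := chaosDiss σ N (Φ N) ψ h δ t z
    set s := S N
    -- R ≥ (1-δ) a - η' s ; a ≥ e - r - η' s ; e ≥ W - η' s ; r ≤ (1 - c₀) W + η' s ; C ≤ K₀ W + η' s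
    have k1 : (1 - δ) * (e - r - η' * s) ≤ (1 - δ) * a := mul_le_mul_of_nonneg_left (by linarith) h1δ.le
    have k1' : (1 - δ) * (c₀ * W - 3 * (η' * s)) ≤ (1 - δ) * (e - r - η' * s) :=
      mul_le_mul_of_nonneg_left (by linarith) h1δ.le
    have k2 : (1 - δ) * c₀ * W - (3 * (1 - δ) + 1) * (η' * s) ≤ R := by linarith
    have k3 : c₁ * C ≤ (1 - δ) * c₀ * W + c₁ * (η' * s) := by
      have h4' : c₁ * C ≤ c₁ * (K₀ * W + η' * s) := mul_le_mul_of_nonneg_left h4 hc₁.le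
      have e1 : c₁ * K₀ = (1 - δ) * c₀ := by rw [hc₁_def]; field_simp
      have e2 : c₁ * (K₀ * W + η' * s) = (1 - δ) * c₀ * W + c₁ * (η' * s) := by rw [← e1]; ring
      linarith
    have k4 : c₁ * C ≤ R + D * (η' * s) := by
      have e3 : D * (η' * s) = c₁ * (η' * s) + (3 * (1 - δ) + 1) * (η' * s) := by rw [hD_def]; ring
      linarith
    have k5 : D * (η' * s) = η * s := by rw [← mul_assoc, hDη']
    rw [k5] at k4
    exact absurd hz (not_lt.2 k4)
  have hle : ∀ N : ℕ, localGibbsLaw σ a₀ u₀ θ₀ N (Φ N)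
      {z | realDiss σ N (Φ N) ψ h δ t z + η * ((N + 1 : ℕ) : ℝ) ^ ((1 : ℝ) / 3) <
        c₁ * chaosDiss σ N (Φ N) ψ h δ t z} ≤
      localGibbsLaw σ a₀ u₀ θ₀ N (Φ N) (E1 N) + localGibbsLaw σ a₀ u₀ θ₀ N (Φ N) (E2 N) +
        localGibbsLaw σ a₀ u₀ θ₀ N (Φ N) (E3 N) + localGibbsLaw σ a₀ u₀ θ₀ N (Φ N) (E4 N) +
        localGibbsLaw σ a₀ u₀ θ₀ N (Φ N) (E5 N) := by
    intro N
    refine (measure_mono (hincl N)).trans ?_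
    refine (measure_union_le _ _).trans (add_le_add ?_ le_rfl)
    refine (measure_union_le _ _).trans (add_le_add ?_ le_rfl)
    refine (measure_union_le _ _).trans (add_le_add ?_ le_rfl)
    exact measure_union_le _ _
  have hsum : Tendsto (fun N : ℕ => localGibbsLaw σ a₀ u₀ θ₀ N (Φ N) (E1 N) +
      localGibbsLaw σ a₀ u₀ θ₀ N (Φ N) (E2 N) + localGibbsLaw σ a₀ u₀ θ₀ N (Φ N) (E3 N) +
      localGibbsLaw σ a₀ u₀ θ₀ N (Φ N) (E4 N) + localGibbsLaw σ a₀ u₀ θ₀ N (Φ N) (E5 N)) atTop (𝓝 0) := by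
    simpa using (((T1.add T2).add T3').add T4).add T5
  exact tendsto_of_tendsto_of_tendsto_of_le_of_le' tendsto_const_nhds hsum
    (Eventually.of_forall fun N => bot_le) (Eventually.of_forall hle)

end DVTransfer

/-! ## Registered anchor of this support file -/

/-- ANCHOR (registered helper stub `bhDVTransfer_glue_anchor` of the crux item): the conditional transfer — for
`δ < 1`, `K₀ > 0` and functionals `A`, `E` with (G1) `realDiss ≥ (1−δ)A`, (G2) `A ≥ E − relEnt`,
(G3) `E ≥ chaosDissW`, (G4) `chaosDiss ≤ K₀ chaosDissW`, each up to `o_P((N+1)^{1/3})`, the residue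
`EntropyChaosRelOn` implies `OneSidedOn`. -/
theorem bhDVTransfer_glue_anchor : ∀ (σ : ℝ) (a₀ θ₀ : T3 → ℝ) (u₀ : T3 → V3) (Φ : Flows σ) (ψ : ℕ → T3 → ℝ) (γc h δ t : ℝ), δ < 1 → ∀ (A E : (N : ℕ) → Cfg N → ℝ) (K₀ : ℝ), 0 < K₀ → (∀ η : ℝ, 0 < η → Tendsto (fun N : ℕ => localGibbsLaw σ a₀ u₀ θ₀ N (Φ N) {z | realDiss σ N (Φ N) ψ h δ t z + η * ((N + 1 : ℕ) : ℝ) ^ ((1 : ℝ) / 3) < (1 - δ) * A N z}) atTop (𝓝 0)) → (∀ η : ℝ, 0 < η → Tendsto (fun N : ℕ => localGibbsLaw σ a₀ u₀ θ₀ N (Φ N) {z | A N z + η * ((N + 1 : ℕ) : ℝ) ^ ((1 : ℝ) / 3) < E N z - relEnt σ N (Φ N) ψ γc h t z}) atTop (𝓝 0)) → (∀ η : ℝ, 0 < η → Tendsto (fun N : ℕ => localGibbsLaw σ a₀ u₀ θ₀ N (Φ N) {z | E N z + η * ((N + 1 : ℕ) : ℝ) ^ ((1 : ℝ) / 3) <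 chaosDissW σ N (Φ N) ψ γc h δ t z}) atTop (𝓝 0)) → (∀ η : ℝ, 0 < η → Tendsto (fun N : ℕ => localGibbsLaw σ a₀ u₀ θ₀ N (Φ N) {z | K₀ * chaosDissW σ N (Φ N) ψ γc h δ t z + η * ((N + 1 : ℕ) : ℝ) ^ ((1 : ℝ) / 3) < chaosDiss σ N (Φ N) ψ h δ t z}) atTop (𝓝 0)) → EntropyChaosRelOn σ a₀ θ₀ u₀ Φ ψ γc h δ t → OneSidedOn σ a₀ θ₀ u₀ Φ ψ h δ t :=
  fun _ _ _ _ _ _ _ _ _ _ hδ A E _ hK₀ G1 G2 G3 G4 hR => DVTransfer.oneSidedOn_of_dvChain hδ A E hK₀ G1 G2 G3 G4 hR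

end

end Summit.AtomisticToContinuum.HydrodynamicLimit.Theorems.BlockHDissipation
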